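import Summits.QuantumFields.YangMills.Theorems.FluctuationComparisonRegPrIntLLoopLedgerSmoothCut
import HarnessLib

/-!
# S3-CUTPROD: the PRODUCT small-field cut `Π_{x ∈ S} χ_P(φ x)` on `ι → ℝ` — GREP's atom-factor cut in GREP's own currency: `ContDiff ℝ ∞`, atom-local (sees only the
# coordinates in `S`), `= 1` on the inner box, `= 0` off the outer box, values in `[0,1]`, and a `P`-FREE, `φ`-FREE table `‖Dⁿ(Π χ)(φ)‖ ≤ C #S n`

Cell `ym3-torus` (YM ladder rung R3 = continuum `SU(2)` Yang–Mills on the three-torus — a RUNG, NOT d = 4, NOT infinite volume, NOT a mass gap, NOT Clay).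
Width seat `ym3-torus-px20` (gen 16); `--supports stmt-QuantumFields-20520 --as helper`, count-neutral, definition-free, default heartbeats; registry v11.4 №36
untouched.  ✓`…LoopLedgerSmoothCut` (p797861) supplies the one-variable cut `χ_P t = smoothTransition(P − t)·smoothTransition(P + t)` with an all-order `P`-free table;
GREP (✓`AnchorGap.stub_gaussianBBFPolymerRep`) reads atom factors `G_b : (ι → ℝ) → ℝ` with `ContDiff ℝ ⊤`, poly-growth tables `‖iteratedFDeriv ℝ n (G b) φ‖ ≤ …` and the
atom-locality clause `(∀ i, blk i = b → φ i = ψ i) → G b φ = G b ψ`.  This file lifts the cut to that currency, Mathlib-only beyond FILE 6: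
* §1 one site: `contDiff_cut_apply`, `norm_proj_le_one`, ★`norm_iteratedFDeriv_cut_apply_le` (`‖Dⁿ(φ ↦ χ_P(φ x))(φ)‖ ≤ c n`, the SAME `P`-free table as FILE 6:
  `ContinuousLinearMap.iteratedFDeriv_comp_right` + `norm_compContinuousLinearMap_le` + `‖proj x‖ ≤ 1`).
* §2 the product over a finite site set `S`: `contDiff_cutProd`, `cutProd_nonneg`, `cutProd_le_one`, `cutProd_eq_one` (inner box `∀ x ∈ S, |φ x| ≤ P − 1`), `cutProd_eq_zero`
  (some `x ∈ S` with `P ≤ |φ x|`), ★`cutProd_local` (GREP's atom-locality shape: `φ = ψ` on `S` ⟹ equal), ★★`exists_uniform_iteratedFDeriv_cutProd_bound`: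
  `∃ C : ℕ → ℕ → ℝ, (∀ k n, 0 ≤ C k n) ∧ ∀ P S n φ, ‖iteratedFDeriv ℝ n (fun φ => ∏ x ∈ S, χ_P (φ x)) φ‖ ≤ C S.card n` (induction on `S` with Mathlib's two-factor Leibniz
  bound `norm_iteratedFDeriv_mul_le`; the table is the explicit recursion `C 0 n = [n = 0]`, `C (k+1) n = Σᵢ C(n,i)·c i·C k (n−i)`).

HONEST SCOPE.  [folklore] calculus; a SUPPLY theorem in GREP's currency — decides nothing about v18's cut design (R-CUT-χ of record), proves nothing of GREP's assembly, the
large-field side, Bałaban's expansions, GAS∕GAS₁∕REP∕H4ᶜ∕S2β or `FluctuationComparisonRegPrIntL` (stmt-QuantumFields-20520); no summit statement is proved by a helper; rung R3 =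
SU(2) YM₃ on T³ — NOT d = 4, NOT infinite volume, NOT a mass gap, NOT Clay; the Yang–Mills mass gap is NOT proved.

References: T. Bałaban, CMP **122** (1989) [Balaban1989LargeFieldII] §1; D. C. Brydges, Les Houches 1984 [Brydges1986] §3; T. Bałaban, CMP **102** (1985) [Balaban1985UV3] ((22)).
-/

set_option autoImplicit false

noncomputable section

open Finset

namespace Summit.QuantumFields.YangMills.Theorems.LoopLedgerSmoothCutProduct

open Summit.QuantumFields.YangMills.Theorems.LoopLedgerSmoothCut

variable {ι : Type*} [Fintype ι] [DecidableEq ι]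

/-! ## §1 One site -/

omit [DecidableEq ι] in
/-- the coordinate projection has operator norm `≤ 1` on the sup-normed `ι → ℝ`. [folklore] -/
theorem norm_proj_le_one (x : ι) : ‖(ContinuousLinearMap.proj x : (ι → ℝ) →L[ℝ] ℝ)‖ ≤ 1 :=
  ContinuousLinearMap.opNorm_le_bound _ zero_le_one fun φ => by
    rw [one_mul, ContinuousLinearMap.proj_apply]
    exact norm_le_pi_norm φ x

omit [DecidableEq ι] in
/-- the one-site cut `φ ↦ χ_P(φ x)` is smooth. [folklore] -/
theorem contDiff_cut_apply (P : ℝ) (x : ι) {N : ℕ∞} :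
    ContDiff ℝ N (fun φ : ι → ℝ => Real.smoothTransition (P - φ x) * Real.smoothTransition (P + φ x)) :=
  (cut_contDiff P).comp ((ContinuousLinearMap.proj x : (ι → ℝ) →L[ℝ] ℝ).contDiff)

omit [DecidableEq ι] in
/-- ★ the one-site cut has the SAME `P`-free table as the one-variable cut: `‖Dⁿ(φ ↦ χ_P(φ x))(φ)‖ ≤ ‖Dⁿχ_P(φ x)‖`. [folklore] -/
theorem norm_iteratedFDeriv_cut_apply_le (P : ℝ) (x : ι) (n : ℕ) (φ : ι → ℝ) :
    ‖iteratedFDeriv ℝ n (fun φ : ι → ℝ => Real.smoothTransition (P - φ x) * Real.smoothTransition (P + φ x)) φ‖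
      ≤ ‖iteratedDeriv n (fun t : ℝ => Real.smoothTransition (P - t) * Real.smoothTransition (P + t)) (φ x)‖ := by
  have hcomp : (fun φ : ι → ℝ => Real.smoothTransition (P - φ x) * Real.smoothTransition (P + φ x))
      = (fun t : ℝ => Real.smoothTransition (P - t) * Real.smoothTransition (P + t)) ∘ (ContinuousLinearMap.proj x : (ι → ℝ) →L[ℝ] ℝ) := by
    funext φ
    rfl
  rw [hcomp, ContinuousLinearMap.iteratedFDeriv_comp_right _ (cut_contDiff P (N := (n : ℕ∞))) φ (by exact_mod_cast le_rfl),
    ← norm_iteratedFDeriv_eq_norm_iteratedDeriv]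
  refine (ContinuousMultilinearMap.norm_compContinuousLinearMap_le _ _).trans ?_
  have hprod : ∏ _i : Fin n, ‖(ContinuousLinearMap.proj x : (ι → ℝ) →L[ℝ] ℝ)‖ ≤ 1 :=
    Finset.prod_le_one (fun _ _ => norm_nonneg _) fun _ _ => norm_proj_le_one x
  calc ‖iteratedFDeriv ℝ n (fun t : ℝ => Real.smoothTransition (P - t) * Real.smoothTransition (P + t)) ((ContinuousLinearMap.proj x : (ι → ℝ) →L[ℝ] ℝ) φ)‖
        * ∏ _i : Fin n, ‖(ContinuousLinearMap.proj x : (ι → ℝ) →L[ℝ] ℝ)‖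
      ≤ ‖iteratedFDeriv ℝ n (fun t : ℝ => Real.smoothTransition (P - t) * Real.smoothTransition (P + t)) ((ContinuousLinearMap.proj x : (ι → ℝ) →L[ℝ] ℝ) φ)‖ * 1 :=
        mul_le_mul_of_nonneg_left hprod (norm_nonneg _)
    _ = _ := by rw [mul_one]; rfl

/-! ## §2 The product over a finite site set -/

omit [DecidableEq ι] in
/-- the product cut is smooth. [folklore] -/
theorem contDiff_cutProd (P : ℝ) (S : Finset ι) {N : ℕ∞} :
    ContDiff ℝ N (fun φ : ι → ℝ => ∏ x ∈ S, Real.smoothTransition (P - φ x) * Real.smoothTransition (P + φ x)) :=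
  contDiff_prod fun x _ => contDiff_cut_apply P x

omit [Fintype ι] [DecidableEq ι] in
/-- `0 ≤ Π χ`. [folklore] -/
theorem cutProd_nonneg (P : ℝ) (S : Finset ι) (φ : ι → ℝ) : 0 ≤ ∏ x ∈ S, Real.smoothTransition (P - φ x) * Real.smoothTransition (P + φ x) :=
  Finset.prod_nonneg fun x _ => cut_nonneg P (φ x)

omit [Fintype ι] [DecidableEq ι] in
/-- `Π χ ≤ 1`. [folklore] -/
theorem cutProd_le_one (P : ℝ) (S : Finset ι) (φ : ι → ℝ) : ∏ x ∈ S, Real.smoothTransition (P - φ x) * Real.smoothTransition (P + φ x) ≤ 1 :=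
  Finset.prod_le_one (fun x _ => cut_nonneg P (φ x)) fun x _ => cut_le_one P (φ x)

omit [Fintype ι] [DecidableEq ι] in
/-- `Π χ = 1` on the inner box. [folklore] -/
theorem cutProd_eq_one {P : ℝ} {S : Finset ι} {φ : ι → ℝ} (h : ∀ x ∈ S, |φ x| ≤ P - 1) :
    ∏ x ∈ S, Real.smoothTransition (P - φ x) * Real.smoothTransition (P + φ x) = 1 :=
  Finset.prod_eq_one fun x hx => cut_eq_one (h x hx)

omit [Fintype ι] [DecidableEq ι] in
/-- `Π χ = 0` as soon as one coordinate of `S` leaves the outer box. [folklore] -/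
theorem cutProd_eq_zero {P : ℝ} {S : Finset ι} {φ : ι → ℝ} {x : ι} (hx : x ∈ S) (h : P ≤ |φ x|) :
    ∏ x ∈ S, Real.smoothTransition (P - φ x) * Real.smoothTransition (P + φ x) = 0 :=
  Finset.prod_eq_zero hx (cut_eq_zero h)

omit [Fintype ι] [DecidableEq ι] in
/-- ★ GREP's atom-locality shape: the product cut sees only the coordinates in `S`. [folklore] -/
theorem cutProd_local (P : ℝ) (S : Finset ι) {φ ψ : ι → ℝ} (h : ∀ x ∈ S, φ x = ψ x) :
    ∏ x ∈ S, Real.smoothTransition (P - φ x) * Real.smoothTransition (P + φ x) = ∏ x ∈ S, Real.smoothTransition (P - ψ x) * Real.smoothTransition (P + ψ x) :=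
  Finset.prod_congr rfl fun x hx => by rw [h x hx]

/-- ★★ **THE `P`-FREE, `φ`-FREE TABLE OF THE PRODUCT CUT.**  There is `C : ℕ → ℕ → ℝ`, `C ≥ 0`, depending only on (number of sites, order), with
`‖Dⁿ(φ ↦ Π_{x∈S} χ_P(φ x))(φ)‖ ≤ C #S n` for every `P`, `S`, `n`, `φ` — induction on `S` with Mathlib's two-factor Leibniz bound `norm_iteratedFDeriv_mul_le` over §1 and FILE 6's
one-variable table. [folklore] -/
theorem exists_uniform_iteratedFDeriv_cutProd_bound :
    ∃ C : ℕ → ℕ → ℝ, (∀ k n, 0 ≤ C k n) ∧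
      ∀ (P : ℝ) (S : Finset ι) (n : ℕ) (φ : ι → ℝ),
        ‖iteratedFDeriv ℝ n (fun φ : ι → ℝ => ∏ x ∈ S, Real.smoothTransition (P - φ x) * Real.smoothTransition (P + φ x)) φ‖ ≤ C S.card n := by
  classical
  obtain ⟨c, hc0, hc⟩ := exists_uniform_iteratedDeriv_cut_bound
  -- the recursive table
  let C : ℕ → ℕ → ℝ := fun k => Nat.rec (motive := fun _ => ℕ → ℝ) (fun n => if n = 0 then 1 else 0)
    (fun _ T n => ∑ i ∈ Finset.range (n + 1), (n.choose i : ℝ) * c i * T (n - i)) k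
  have hC0 : ∀ n, C 0 n = if n = 0 then 1 else 0 := fun n => rfl
  have hCs : ∀ k n, C (k + 1) n = ∑ i ∈ Finset.range (n + 1), (n.choose i : ℝ) * c i * C k (n - i) := fun k n => rfl
  have hCnn : ∀ k n, 0 ≤ C k n := by
    intro k
    induction k with
    | zero => intro n; rw [hC0]; split_ifs <;> norm_num
    | succ k ih => intro n; rw [hCs]; exact Finset.sum_nonneg fun i _ => mul_nonneg (mul_nonneg (Nat.cast_nonneg _) (hc0 i)) (ih _)
  refine ⟨C, hCnn, fun P S => ?_⟩
  induction S using Finset.induction_on with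
  | empty =>
    intro n φ
    simp only [Finset.prod_empty, Finset.card_empty, hC0]
    rcases Nat.eq_zero_or_pos n with hn | hn
    · subst hn
      simp
    · rw [iteratedFDeriv_const_of_ne hn.ne', if_neg hn.ne']
      simp
  | insert a S haS ih =>
    intro n φ
    rw [Finset.card_insert_of_notMem haS, hCs]
    have hfun : (fun φ : ι → ℝ => ∏ x ∈ insert a S, Real.smoothTransition (P - φ x) * Real.smoothTransition (P + φ x))
        = fun φ => (Real.smoothTransition (P - φ a) * Real.smoothTransition (P + φ a))
            * ∏ x ∈ S, Real.smoothTransition (P - φ x) * Real.smoothTransition (P + φ x) := by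
      funext φ
      rw [Finset.prod_insert haS]
    rw [hfun]
    refine (norm_iteratedFDeriv_mul_le (contDiff_cut_apply P a (N := (n : ℕ∞))) (contDiff_cutProd P S (N := (n : ℕ∞))) φ
      (by exact_mod_cast le_rfl)).trans (Finset.sum_le_sum fun i hi => ?_)
    have h1 : ‖iteratedFDeriv ℝ i (fun φ : ι → ℝ => Real.smoothTransition (P - φ a) * Real.smoothTransition (P + φ a)) φ‖ ≤ c i :=
      (norm_iteratedFDeriv_cut_apply_le P a i φ).trans (hc i P (φ a))
    have h2 := ih (n - i) φ
    rw [mul_assoc, mul_assoc]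
    exact mul_le_mul_of_nonneg_left (mul_le_mul h1 h2 (norm_nonneg _) (hc0 i)) (Nat.cast_nonneg _)

end Summit.QuantumFields.YangMills.Theorems.LoopLedgerSmoothCutProduct

end
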